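import Literature.NumberTheory.EllipticCurves.QuadraticTwistSelmerInfty
import Literature.NumberTheory.EllipticCurves.H1CorestrictionIndexTwo
import Literature.NumberTheory.EllipticCurves.SelmerRestrictionCorankRelative
import Literature.NumberTheory.EllipticCurves.IwasawaSelmerProofs
import Mathlib.FieldTheory.KrullTopology
import HarnessLib

/-!
# The `±`-decomposition of `Sel_{p^∞}(E/K_∞(√d))` along the quadratic layer `K_∞(√d)/K_∞` of a
# `ℤ_p`-tower, INSIDE `Γ_K`: `Sel(E/K_∞) × Sel(E^{(d)}/K_∞) → Sel(E/K_∞(√d))` has kernel and cokernel killed by `4`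

Greenberg, *Iwasawa theory for elliptic curves*, LNM 1716 (1999), §4 p. 107 (twisting `A ↦ A_s`: «as
`G_{F_∞}`-modules `A_s = A`»), §1 p. 60; T. Dokchitser, V. Dokchitser, Ann. of Math. 172 (2010), Lemma 4.14
(restriction to an index-`2` subgroup: kernel and cokernel killed by `|G|²`; `X_p(E/F) = X⁺ ⊕ X⁻` with
`X⁻ = X_p(E_α/K)`); K. Rubin, *Euler Systems* VI §1–§2. The tree proves the NUMBER-FIELD case
(`selmerCorank_baseChange_quadratic_holds`, `BSDSelmerParityDokchitserBaseChangeProofs`) with the generic engine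
`IndexTwoDecompositionData` (`H1CorestrictionIndexTwo`). This file runs the same engine ONE LEVEL UP, over the top
`K_∞ = K̄^{ker κ}` of a `ℤ_p`-extension `κ` of a number field `K` and its quadratic extension `K_∞(θ)`, `θ² = d ∈ K`,
`θ ∉ K_∞` — entirely in the tree's SUBGROUP MODEL of Selmer groups over infinite extensions
(`WeierstrassCurve.selmerGroupOver W p H`, `H ≤ Γ_K`; file `SubgroupSelmer`):

* §1 `kerStab κ θ = ker κ ⊓ Stab(θ) = Gal(K̄/K_∞(θ))`: normal, of index `2` in `ker κ` (given `c ∈ ker κ` with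
  `c θ = −θ`), its copy inside `ker κ` open.
* §2 a variant of the tree's `relIndex_nsmul_mem_selmerGroupOver_of_resOfLe_mem` for a CLOSED subgroup of finite
  index (the tree's version asks `H` open in `Γ_K`; `ker κ` is not).
* §3 the twisting data: `e : E₂(K̄) ≃+ E(K̄)` for any `K`-model `E₂` of `E^{(d)}` with the sign rule
  `e(σP) = χ_θ(σ)·σ·e(P)`, its `p`-primary part `ψ`, and `Ψ = Ψ_e` on `H¹(kerStab, ·)` carrying
  `Sel(E₂/K_∞(θ))` onto `Sel(E/K_∞(θ))` (the tree's `CoeffTwist`/`QuadraticTwistSelmer` machinery at `H = kerStab`).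
* §4 **`quadraticLayerData`** : `IndexTwoDecompositionData` for `G = ker κ`, `N = kerStab`, `M = E[p^∞]`,
  `M′ = E₂[p^∞]`, `S = Sel(E/K_∞)`, `S′ = Sel(E₂/K_∞)`, `T = Sel(E/K_∞(θ))` (transported to the copy of `N` in `G`),
  `a = 1`; hence (§5) the comparison `(η, η′) ↦ res η + Ψ(res η′)` of `Sel(E/K_∞) × Sel(E₂/K_∞)` with
  `Sel(E/K_∞(θ))` has **kernel killed by `4`** (`four_nsmul_eq_zero_of_res_add_twistRes_eq_zero`) and **`4 · Sel(E/K_∞(θ))`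
  in its image** (`exists_res_add_twistRes_eq_four_nsmul`).

Everything is proved (no named fact, no instance, no `sorry`). Motivation (cell `bsd-2adic`, seat `t42` GEN 23, crux
stmt-BirchSwinnertonDyer-22618, T20 (a)): `K = ℚ`, `p = 2`, `d = −1`, `E′` the split-multiplicative twist of an
additive curve `E = E′^{(−1)}`: `X(E′/ℚ_∞(i)) → X(E′/ℚ_∞) × X(E/ℚ_∞)` is a `Λ`-quasi-isomorphism (dual side: file
`IwasawaSelmerDualFunctorialityProofs`), so the height-one lengths away from `(2)` ADD — the decomposition reading
`hdec` of `Theorems/ByReductionTypeAtTwoAdditiveKatoTransportSymmetry`. That application is NOT made here.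

## References

* [GreenbergLNM1716] R. Greenberg, LNM 1716 (1999), §1 (p. 60), §4 (p. 107).
* [DokchitserDokchitserAnnals2010] T. Dokchitser, V. Dokchitser, Ann. of Math. 172 (2010), Lemma 4.14 (proof).
* [Rubin2000] K. Rubin, *Euler Systems*, Ch. VI §1–§2.
* [SerreGaloisCohomology1997] J.-P. Serre, *Galois Cohomology*, I.§2.4, II.§1.1.
-/

noncomputable section

open scoped Classical

universe u

namespace Literature.NumberTheory.EllipticCurves

namespace QuadraticLayer

open WeierstrassCurve NumberField IsDedekindDomain CoeffTwist QuadraticTwistSelmer GaloisRepresentations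

/-! ## §1 The subgroup `kerStab κ θ = Gal(K̄/K_∞(θ))` -/

section KerStab

variable {K : Type u} [Field K] {p : ℕ} [Fact p.Prime] (κ : ZpExtension K p) (θ : AlgebraicClosure K)

/-- `Gal(K̄/K_∞(θ)) = ker κ ⊓ Stab_{Γ_K}(θ)`: the absolute Galois group of the quadratic (or trivial) extension
`K_∞(θ)` of the top of the `ℤ_p`-tower. [cite: GreenbergLNM1716, §4 p. 107] -/
def kerStab : Subgroup (Field.absoluteGaloisGroup K) :=
  κ.kerSubgroup ⊓ MulAction.stabilizer (Field.absoluteGaloisGroup K) θ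

/-- Membership in `kerStab`. [cite: GreenbergLNM1716, §4 p. 107] -/
theorem mem_kerStab_iff (σ : Field.absoluteGaloisGroup K) : σ ∈ kerStab κ θ ↔ σ ∈ κ.kerSubgroup ∧ σ • θ = θ :=
  Iff.rfl

/-- `kerStab ≤ ker κ`. [cite: GreenbergLNM1716, §4 p. 107] -/
theorem kerStab_le : kerStab κ θ ≤ κ.kerSubgroup := inf_le_left

/-- `kerStab` fixes `θ`. [cite: GreenbergLNM1716, §4 p. 107] -/
theorem smul_eq_of_mem_kerStab {σ : Field.absoluteGaloisGroup K} (hσ : σ ∈ kerStab κ θ) : σ • θ = θ := hσ.2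

variable {θ} {d : K} (hd : d ≠ 0) (hθ : θ ^ 2 = algebraMap K (AlgebraicClosure K) d)

include hθ in
/-- `kerStab κ θ` is normal in `Γ_K` (`θ² ∈ K`: every `τ` maps `θ` to `±θ`). [cite: GreenbergLNM1716, §4 p. 107] -/
theorem normal_kerStab : (kerStab κ θ).Normal := by
  refine ⟨fun σ hσ τ ↦ ⟨(ZpExtension.kerSubgroup_normal κ).conj_mem σ hσ.1 τ, ?_⟩⟩
  change (τ * σ * τ⁻¹) • θ = θ
  have hσθ : σ • θ = θ := hσ.2
  have hinv : τ⁻¹ • θ = θ ∨ τ⁻¹ • θ = -θ := smul_sqrt_eq_or_eq_neg hθ τ⁻¹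
  rw [mul_smul, mul_smul]
  rcases hinv with h | h
  · rw [h, hσθ]
    nth_rw 1 [← h]
    exact smul_inv_smul τ θ
  · rw [h, smul_neg, hσθ, ← h, smul_inv_smul]

/-- `Stab(θ)` contains the open subgroup `Gal(K̄/K(θ))`, hence is open. [folklore] -/
private theorem isOpen_stabilizer (θ : AlgebraicClosure K) :
    IsOpen (MulAction.stabilizer (Field.absoluteGaloisGroup K) θ : Set (Field.absoluteGaloisGroup K)) := by
  have hint : IsIntegral K θ := (Algebra.IsAlgebraic.isAlgebraic (R := K) θ).isIntegral
  haveI : FiniteDimensional K (IntermediateField.adjoin K {θ}) := IntermediateField.adjoin.finiteDimensional hint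
  apply Subgroup.isOpen_mono (H₁ := (IntermediateField.adjoin K {θ}).fixingSubgroup)
  · intro σ hσ
    exact (IntermediateField.mem_fixingSubgroup_iff _ _).mp hσ θ (IntermediateField.mem_adjoin_simple_self K θ)
  · exact IntermediateField.fixingSubgroup_isOpen _

/-- The copy of `kerStab` inside `ker κ` is open (preimage of the open `Stab(θ) ⊇ Gal(K̄/K(θ))`, Krull topology).
[cite: SerreGaloisCohomology1997, II.§1.1] -/
theorem isOpen_kerStab_subgroupOf (θ : AlgebraicClosure K) :
    IsOpen ((kerStab κ θ).subgroupOf κ.kerSubgroup : Set κ.kerSubgroup) := by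
  have h : ((kerStab κ θ).subgroupOf κ.kerSubgroup : Set κ.kerSubgroup) =
      Subtype.val ⁻¹' (MulAction.stabilizer (Field.absoluteGaloisGroup K) θ : Set (Field.absoluteGaloisGroup K)) := by
    ext x
    simp only [SetLike.mem_coe, Subgroup.mem_subgroupOf, mem_kerStab_iff, Set.mem_preimage]
    exact ⟨fun h ↦ h.2, fun h ↦ ⟨x.2, h⟩⟩
  rw [h]
  exact (isOpen_stabilizer θ).preimage continuous_subtype_val

/-- `kerStab` is closed (Krull topology). [cite: SerreGaloisCohomology1997, II.§1.1] -/
theorem isClosed_kerStab (θ : AlgebraicClosure K) :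
    IsClosed (kerStab κ θ : Set (Field.absoluteGaloisGroup K)) := by
  have h1 : IsClosed (κ.kerSubgroup : Set (Field.absoluteGaloisGroup K)) := κ.isClosed_kerSubgroup
  have h2 : IsClosed (MulAction.stabilizer (Field.absoluteGaloisGroup K) θ : Set (Field.absoluteGaloisGroup K)) :=
    Subgroup.isClosed_of_isOpen _ (isOpen_stabilizer θ)
  exact h1.inter h2

variable [CharZero K] {c : Field.absoluteGaloisGroup K} (hcκ : c ∈ κ.kerSubgroup) (hcθ : c • θ = -θ)

include hd hθ hcθ in
/-- With `c ∈ ker κ`, `c θ = −θ`: `b c⁻¹ ∈ kerStab ↔ b ∉ kerStab` for `b ∈ ker κ` — `ker κ = kerStab ⊔ kerStab·c`.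
[cite: DokchitserDokchitserAnnals2010, Lemma 4.14 (proof)] -/
theorem xor_kerStab (b : κ.kerSubgroup) :
    Xor (b * (⟨c, hcκ⟩ : κ.kerSubgroup)⁻¹ ∈ (kerStab κ θ).subgroupOf κ.kerSubgroup)
      (b ∈ (kerStab κ θ).subgroupOf κ.kerSubgroup) := by
  have hθ0 : θ ≠ 0 := sqrt_ne_zero_of_sq_eq hd hθ
  have hneg : -θ ≠ θ := fun h ↦ hθ0 (by
    have h2 : (2 : AlgebraicClosure K) * θ = 0 := by linear_combination -h
    exact (mul_eq_zero.mp h2).resolve_left two_ne_zero)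
  have hcinv : c⁻¹ • θ = -θ := by
    have h1 : c⁻¹ • c • θ = c⁻¹ • (-θ) := by rw [hcθ]
    rw [inv_smul_smul, smul_neg] at h1
    exact (neg_eq_iff_eq_neg.mpr h1).symm
  have hbc : ((b : Field.absoluteGaloisGroup K) * c⁻¹) • θ = -((b : Field.absoluteGaloisGroup K) • θ) := by
    rw [mul_smul, hcinv, smul_neg]
  simp only [Subgroup.mem_subgroupOf, Subgroup.coe_mul, Subgroup.coe_inv, mem_kerStab_iff]
  have hb1 : ((b : Field.absoluteGaloisGroup K) * c⁻¹) ∈ κ.kerSubgroup :=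
    κ.kerSubgroup.mul_mem b.2 (κ.kerSubgroup.inv_mem hcκ)
  rcases smul_sqrt_eq_or_eq_neg hθ (b : Field.absoluteGaloisGroup K) with h | h
  · refine Or.inr ⟨⟨b.2, h⟩, fun h' ↦ hneg ?_⟩
    calc -θ = -((b : Field.absoluteGaloisGroup K) • θ) := by rw [h]
      _ = ((b : Field.absoluteGaloisGroup K) * c⁻¹) • θ := hbc.symm
      _ = θ := h'.2
  · exact Or.inl ⟨⟨hb1, by rw [hbc, h, neg_neg]⟩, fun h' ↦ hneg (h.symm.trans h'.2)⟩

include hd hθ hcκ hcθ in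
/-- `[ker κ : kerStab] = 2`. [cite: DokchitserDokchitserAnnals2010, Lemma 4.14 (proof)] -/
theorem relIndex_kerStab : (kerStab κ θ).relIndex κ.kerSubgroup = 2 :=
  Subgroup.index_eq_two_iff.mpr ⟨(⟨c, hcκ⟩ : κ.kerSubgroup)⁻¹, xor_kerStab κ hd hθ hcκ hcθ⟩

include hd hθ hcκ hcθ in
/-- `kerStab` has finite index (`= 2`) in `ker κ`. [cite: DokchitserDokchitserAnnals2010, Lemma 4.14 (proof)] -/
theorem finiteIndex_kerStab_subgroupOf : ((kerStab κ θ).subgroupOf κ.kerSubgroup).FiniteIndex :=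
  ⟨by rw [show ((kerStab κ θ).subgroupOf κ.kerSubgroup).index = 2 from relIndex_kerStab κ hd hθ hcκ hcθ]; norm_num⟩

end KerStab

/-! ## §2 `res_{H'→H} η ∈ Sel(E/K̄^H) ⇒ [H′:H]·η ∈ Sel(E/K̄^{H′})` for `H` CLOSED of finite index in `H′` -/

section Relative

variable {K : Type u} [Field K] [NumberField K] (W : WeierstrassCurve K) (p : ℕ)
  {H H' : Subgroup (Field.absoluteGaloisGroup K)} [H.Normal] [H'.Normal]

omit [NumberField K] [H'.Normal] in
/-- One place: if `res_{H′→H} η` dies in `H¹(H_E, E(K̄_E))` then `[H′ : H] • η` dies in `H¹(H′_E, E(K̄_E))`, for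
`H ≤ H′` with the copy of `H` OPEN in `H′` (e.g. `H` closed of finite index in `H′`; the tree's
`relIndex_nsmul_mem_localKerOver_of_resOfLe_mem` asks `H` open in `Γ_K`): `cor ∘ res` inside `H′_E`, whose subgroup
`H_E` is the preimage of `H` and is open in `H′_E`. [cite: DokchitserDokchitserAnnals2010, Lemma 4.14 (proof)] -/
theorem relIndex_nsmul_mem_localKerOver_of_resOfLe_mem' {E : Type u} [Field E] [Algebra K E] (h : H ≤ H')
    (hH : IsOpen ((H.subgroupOf H') : Set H')) (hfi : (H.subgroupOf H').FiniteIndex) {η : W.subgroupH1 p H'}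
    (hη : W.resOfLe p h η ∈ W.localKerOver p H E) :
    H.relIndex H' • η ∈ W.localKerOver p H' E := by
  haveI := hfi
  set ι := closureEmb (K := K) E with hι
  rw [localKerOver_eq_ofEmb, localKerOverOfEmb, AddMonoidHom.mem_ker] at hη ⊢
  rw [W.localResOverOfEmb_resOfLe p ι h] at hη
  have hle : localSubgroupOfEmb H ι ≤ localSubgroupOfEmb H' ι := Subgroup.comap_mono h
  have hη' : resOfLe (localPoints W E) hle (W.localResOverOfEmb p H' ι η) = 0 := hη
  haveI : (localSubgroupOfEmb H ι).Normal := Subgroup.normal_comap _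
  have hdvd : (localSubgroupOfEmb H ι).relIndex (localSubgroupOfEmb H' ι) ∣ H.relIndex H' := by
    rw [localSubgroupOfEmb, localSubgroupOfEmb, Subgroup.relIndex_comap]
    exact relIndex_dvd_relIndex_of_le (Subgroup.map_comap_le _ _)
  haveI hfi : ((localSubgroupOfEmb H ι).subgroupOf (localSubgroupOfEmb H' ι)).FiniteIndex :=
    ⟨fun h0 ↦ Subgroup.FiniteIndex.index_ne_zero
      (Nat.eq_zero_of_zero_dvd ((show (localSubgroupOfEmb H ι).relIndex (localSubgroupOfEmb H' ι) = 0
        from h0) ▸ hdvd))⟩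
  -- the local copy of `H` in `H′_E` is open: it is the preimage of `H.subgroupOf H′` under `H′_E → H′`
  have hopen : IsOpen (((localSubgroupOfEmb H ι).subgroupOf (localSubgroupOfEmb H' ι)) :
      Set (localSubgroupOfEmb H' ι)) := by
    have hset : (((localSubgroupOfEmb H ι).subgroupOf (localSubgroupOfEmb H' ι)) : Set (localSubgroupOfEmb H' ι)) =
        (resGalSubgroupOfEmb H' ι) ⁻¹' ((H.subgroupOf H') : Set H') := by
      ext τ
      simp only [SetLike.mem_coe, Subgroup.mem_subgroupOf, mem_localSubgroupOfEmb_iff, Set.mem_preimage]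
      rfl
    rw [hset]
    exact hH.preimage (resGalSubgroupOfEmb H' ι).continuous_toFun
  haveI : Fintype (↥(localSubgroupOfEmb H' ι) ⧸ (localSubgroupOfEmb H ι).subgroupOf (localSubgroupOfEmb H' ι)) :=
    Fintype.ofFinite _
  have h0 : resSubgroupH1 ((localSubgroupOfEmb H ι).subgroupOf (localSubgroupOfEmb H' ι)) (localPoints W E)
      (W.localResOverOfEmb p H' ι η) = 0 := by
    rw [resSubgroupH1_subgroupOf_eq (localPoints W E) hle, hη', map_zero]
  have hkill : (localSubgroupOfEmb H ι).relIndex (localSubgroupOfEmb H' ι) • W.localResOverOfEmb p H' ι η = 0 :=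
    index_nsmul_eq_zero_of_resSubgroupH1_eq_zero _ hopen h0
  obtain ⟨e, he⟩ := hdvd
  rw [map_nsmul, he, mul_nsmul, hkill, nsmul_zero]

/-- **`res_{H′→H} η ∈ Sel_{p^∞}(E/K̄^H) ⇒ [H′ : H] • η ∈ Sel_{p^∞}(E/K̄^{H′})`** for `H ≤ H′` normal in `Γ_K` with the
copy of `H` open in `H′` (the tree's `relIndex_nsmul_mem_selmerGroupOver_of_resOfLe_mem` for `H` closed of finite
index rather than open). [cite: DokchitserDokchitserAnnals2010, Lemma 4.14 (proof)] -/
theorem relIndex_nsmul_mem_selmerGroupOver_of_resOfLe_mem' (h : H ≤ H')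
    (hH : IsOpen ((H.subgroupOf H') : Set H')) (hfi : (H.subgroupOf H').FiniteIndex)
    {η : W.subgroupH1 p H'} (hη : W.resOfLe p h η ∈ W.selmerGroupOver p H) :
    H.relIndex H' • η ∈ W.selmerGroupOver p H' := by
  rw [mem_selmerGroupOver_iff] at hη ⊢
  have hcomm : ∀ σ, W.conjH1 p H σ (W.resOfLe p h η) = W.resOfLe p h (W.conjH1 p H' σ η) :=
    fun σ ↦ (congrArg (fun f ↦ f η) (resOfLe_comp_conjH1_holds (M := geomPrimaryTorsion W p) h σ)).symm
  refine ⟨fun v σ ↦ ?_, fun w σ ↦ ?_⟩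
  · have h1 := hη.1 v σ
    rw [hcomm] at h1
    rw [map_nsmul]
    exact relIndex_nsmul_mem_localKerOver_of_resOfLe_mem' W p h hH hfi h1
  · have h1 := hη.2 w σ
    rw [hcomm] at h1
    rw [map_nsmul]
    exact relIndex_nsmul_mem_localKerOver_of_resOfLe_mem' W p h hH hfi h1

end Relative

/-! ## §3 The twisting data at `H = kerStab` -/

section Twist

variable {K : Type u} [Field K] [NumberField K] (W W₂ : WeierstrassCurve K) {d : K} (hd : d ≠ 0)
  {V : VariableChange K} (hV : V • W₂ = W.quadraticTwist d)
  {θ : AlgebraicClosure K} (hθ : θ ^ 2 = algebraMap K (AlgebraicClosure K) d)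

/-- A completed square `C • W = W^{(1)}` (a choice, `exists_variableChange_quadraticTwist_one`). [folklore] -/
def sqChange : VariableChange K := Classical.choose W.exists_variableChange_quadraticTwist_one

/-- `sqChange W • W = W^{(1)}`. [folklore] -/
private theorem sqChange_spec : sqChange W • W = W.quadraticTwist 1 :=
  Classical.choose_spec W.exists_variableChange_quadraticTwist_one

/-- **`e : E₂(K̄) ≃+ E(K̄)`** for a `K`-model `E₂` of `E^{(d)}` (`V • W₂ = W^{(d)}`): the `K`-isomorphism
`E₂ ≅ E^{(d)}` followed by the substitution `u = θ = √d` (`twistGeomPointsEquiv`). [cite: SilvermanAEC2009, X.2 Prop. 2.4] -/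
def twistEquiv : W₂.geomPoints ≃+ W.geomPoints :=
  (twistPointsIso hV).trans (twistGeomPointsEquiv W (sqChange_spec W) hd hθ)

/-- **The sign rule `e(σP) = χ_θ(σ)·σ·e(P)`** (`E^{(d)}(K̄) = E(K̄) ⊗ χ_θ`, Silverman X.2 Prop. 2.4; the `K`-isomorphism is
`Γ_K`-equivariant). [cite: SilvermanAEC2009, X.2 Prop. 2.4] [cite: GreenbergLNM1716, §4 p. 107] -/
theorem twistEquiv_smul (σ : Field.absoluteGaloisGroup K) (P : W₂.geomPoints) :
    twistEquiv W W₂ hd hV hθ (σ • P) = quadraticSign θ σ • σ • twistEquiv W W₂ hd hV hθ P := by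
  unfold twistEquiv
  rw [AddEquiv.trans_apply, AddEquiv.trans_apply, twistPointsIso_smul_one hV, one_zsmul,
    twistGeomPointsEquiv_smul_quadraticSign hd hθ W (sqChange_spec W)]

/-- The `p`-primary part `ψ : E₂[p^∞] ≃+ E[p^∞]` of `e`. [cite: GreenbergLNM1716, §4 p. 107] -/
def twistPrimaryEquiv (p : ℕ) : geomPrimaryTorsion W₂ p ≃+ geomPrimaryTorsion W p :=
  primaryComponentCongr (twistEquiv W W₂ hd hV hθ) p

/-- `ψ(σ t) = χ_θ(σ)·σ·ψ(t)`. [cite: GreenbergLNM1716, §4 p. 107] -/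
theorem twistPrimaryEquiv_smul (p : ℕ) (σ : Field.absoluteGaloisGroup K) (t : geomPrimaryTorsion W₂ p) :
    twistPrimaryEquiv W W₂ hd hV hθ p (σ • t) = quadraticSign θ σ • σ • twistPrimaryEquiv W W₂ hd hV hθ p t :=
  primaryComponentCongr_smul p _ _ (twistEquiv_smul W W₂ hd hV hθ) σ t

variable {p : ℕ} [Fact p.Prime] (κ : ZpExtension K p)

omit [NumberField K] in
/-- `χ_θ = 1` on `kerStab κ θ`. [cite: GreenbergLNM1716, §4 p. 107] -/
theorem quadraticSign_of_mem_kerStab (σ : Field.absoluteGaloisGroup K) (hσ : σ ∈ kerStab κ θ) :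
    quadraticSign θ σ = 1 :=
  quadraticSign_of_smul_eq hσ.2

/-- **`Ψ : H¹(K_∞(θ), E₂[p^∞]) ≃+ H¹(K_∞(θ), E[p^∞])`** — `Ψ_e` over the group `kerStab κ θ` (which fixes `θ`, so `e` is
equivariant there): the tree's `coeffH1Equiv`. [cite: GreenbergLNM1716, §4 p. 107] -/
def twistResEquiv : W₂.subgroupH1 p (kerStab κ θ) ≃+ W.subgroupH1 p (kerStab κ θ) :=
  coeffH1Equiv p (kerStab κ θ) (twistEquiv W W₂ hd hV hθ) (quadraticSign θ) (twistEquiv_smul W W₂ hd hV hθ)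
    (quadraticSign_of_mem_kerStab (θ := θ) κ)

/-- **`Ψ` carries `Sel(E₂/K_∞(θ))` onto `Sel(E/K_∞(θ))`**: the local conditions correspond at every completion (the
substitution is defined over `K̄_v ∋ θ_v`; tree lemmas `mem_localKerOver_iff_coeffH1Equiv_mem` for the `K`-isomorphism
part, `twistLocalPointsEquiv` for the substitution), and `Ψ conj_σ = ±conj_σ Ψ`. [cite: GreenbergLNM1716, §4 p. 107]
[cite: Rubin2000, Ch. VI §1–§2] -/
theorem mem_selmerGroupOver_iff_twistResEquiv_mem [(kerStab κ θ).Normal] (x : W₂.subgroupH1 p (kerStab κ θ)) :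
    x ∈ W₂.selmerGroupOver p (kerStab κ θ) ↔ twistResEquiv W W₂ hd hV hθ κ x ∈ W.selmerGroupOver p (kerStab κ θ) := by
  have hH : ∀ σ : Field.absoluteGaloisGroup K, σ ∈ kerStab κ θ → σ • θ = θ := fun σ hσ ↦ hσ.2
  refine mem_selmerGroupOver_iff_coeffH1Equiv_mem p (kerStab κ θ) _ _ _ _ (quadraticSign_eq_one_or θ)
    (fun v y ↦ ?_) (fun w y ↦ ?_) x
  · exact mem_localKerOver_iff_coeffH1Equiv_mem p (kerStab κ θ) _ _ _ _ (v.adicCompletion K)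
      ((twistLocalIso _ hV).trans
        (twistLocalPointsEquiv W (sqChange_spec W) hd (v.adicCompletion K) (closureEmb_sqrt_sq hθ _)))
      (fun τ hτ Q ↦ by
        rw [AddEquiv.trans_apply, AddEquiv.trans_apply, twistLocalIso_smul,
          twistLocalPointsEquiv_smul_of_eq W (sqChange_spec W) hd (closureEmb_sqrt_sq hθ _) τ
            (smul_closureEmb_sqrt_of_mem (kerStab κ θ) hH _ τ hτ)])
      (fun P ↦ by
        unfold twistEquiv
        rw [AddEquiv.trans_apply, AddEquiv.trans_apply, ← pointsMap_twistPointsIso _ hV]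
        exact pointsMapOfEmb_twistGeomPointsEquiv W (sqChange_spec W) hd hθ (closureEmb (K := K) _)
          (closureEmb_sqrt_sq hθ _) rfl _) y
  · exact mem_localKerOver_iff_coeffH1Equiv_mem p (kerStab κ θ) _ _ _ _ w.Completion
      ((twistLocalIso _ hV).trans
        (twistLocalPointsEquiv W (sqChange_spec W) hd w.Completion (closureEmb_sqrt_sq hθ _)))
      (fun τ hτ Q ↦ by
        rw [AddEquiv.trans_apply, AddEquiv.trans_apply, twistLocalIso_smul,
          twistLocalPointsEquiv_smul_of_eq W (sqChange_spec W) hd (closureEmb_sqrt_sq hθ _) τ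
            (smul_closureEmb_sqrt_of_mem (kerStab κ θ) hH _ τ hτ)])
      (fun P ↦ by
        unfold twistEquiv
        rw [AddEquiv.trans_apply, AddEquiv.trans_apply, ← pointsMap_twistPointsIso _ hV]
        exact pointsMapOfEmb_twistGeomPointsEquiv W (sqChange_spec W) hd hθ (closureEmb (K := K) _)
          (closureEmb_sqrt_sq hθ _) rfl _) y

/-- **`Ψ conj_σ = conj_σ Ψ` for `σ` fixing `θ`** (in particular for `σ ∈ kerStab`, and for a generator `γ` of
`Gal(K_∞/K)` chosen in `Stab(θ)`). [cite: GreenbergLNM1716, §4 p. 107] -/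
theorem twistResEquiv_conjH1_of_smul_eq [(kerStab κ θ).Normal] {σ : Field.absoluteGaloisGroup K} (hσ : σ • θ = θ)
    (x : W₂.subgroupH1 p (kerStab κ θ)) :
    twistResEquiv W W₂ hd hV hθ κ (W₂.conjH1 p (kerStab κ θ) σ x) =
      W.conjH1 p (kerStab κ θ) σ (twistResEquiv W W₂ hd hV hθ κ x) := by
  unfold twistResEquiv
  rw [coeffH1Equiv_conjH1, quadraticSign_of_smul_eq hσ, one_zsmul]

end Twist

/-! ## §4 The decomposition data over `K_∞` -/

section Data

variable {K : Type u} [Field K] [NumberField K] {p : ℕ} [Fact p.Prime] (κ : ZpExtension K p)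
  (W W₂ : WeierstrassCurve K) {d : K} (hd : d ≠ 0) {V : VariableChange K} (hV : V • W₂ = W.quadraticTwist d)
  {θ : AlgebraicClosure K} (hθ : θ ^ 2 = algebraMap K (AlgebraicClosure K) d)
  {c : Field.absoluteGaloisGroup K} (hcκ : c ∈ κ.kerSubgroup) (hcθ : c • θ = -θ)

/-- `ψ` is equivariant for the copy of `kerStab` inside `ker κ`. [cite: GreenbergLNM1716, §4 p. 107] -/
theorem twistPrimaryEquiv_smul_subgroupOf (n : (kerStab κ θ).subgroupOf κ.kerSubgroup) (t : geomPrimaryTorsion W₂ p) :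
    twistPrimaryEquiv W W₂ hd hV hθ p (n • t) = n • twistPrimaryEquiv W W₂ hd hV hθ p t := by
  have hn : ((n : κ.kerSubgroup) : Field.absoluteGaloisGroup K) ∈ kerStab κ θ := Subgroup.mem_subgroupOf.mp n.2
  rw [Subgroup.smul_def, Subgroup.smul_def, Subgroup.smul_def, Subgroup.smul_def, twistPrimaryEquiv_smul,
    quadraticSign_of_smul_eq hn.2, one_zsmul]

include hcθ in
/-- `ψ(c t) = −c ψ(t)` for `c θ = −θ`. [cite: DokchitserDokchitserAnnals2010, Lemma 4.14 (proof)] -/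
theorem twistPrimaryEquiv_smul_neg (t : geomPrimaryTorsion W₂ p) :
    twistPrimaryEquiv W W₂ hd hV hθ p ((⟨c, hcκ⟩ : κ.kerSubgroup) • t) =
      -((⟨c, hcκ⟩ : κ.kerSubgroup) • twistPrimaryEquiv W W₂ hd hV hθ p t) := by
  rw [Subgroup.smul_def, Subgroup.smul_def]
  change twistPrimaryEquiv W W₂ hd hV hθ p (c • t) = -(c • twistPrimaryEquiv W W₂ hd hV hθ p t)
  rw [twistPrimaryEquiv_smul, quadraticSign_of_smul_eq_neg (sqrt_ne_zero_of_sq_eq hd hθ) hcθ, neg_one_zsmul]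

omit [NumberField K] in
/-- The orbit maps of `E[p^∞]` under `ker κ` are continuous. [folklore] -/
private theorem continuous_smul_ker (X : WeierstrassCurve K) (m : geomPrimaryTorsion X p) :
    Continuous fun g : κ.kerSubgroup ↦ g • m :=
  (continuous_smul_geomPrimaryTorsion X p m).comp continuous_subtype_val

/-- **`Ψ ∘ res = ψ_* ∘ res` transported**: on `H¹(ker κ, E₂[p^∞])`, restriction to the copy of `kerStab` followed by
`ψ_*` is restriction to `kerStab` followed by `Ψ` and the transport `toSubgroupOfH1` (all four are maps of compatible
pairs; functoriality). [cite: SerreGaloisCohomology1997, I.§2.4] -/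
theorem h1Equiv_resSubgroupH1_eq (η' : W₂.subgroupH1 p κ.kerSubgroup) :
    h1Equiv (twistPrimaryEquiv W W₂ hd hV hθ p) (twistPrimaryEquiv_smul_subgroupOf κ W W₂ hd hV hθ)
        (resSubgroupH1 ((kerStab κ θ).subgroupOf κ.kerSubgroup) (geomPrimaryTorsion W₂ p) η') =
      toSubgroupOfH1 (kerStab κ θ) κ.kerSubgroup (geomPrimaryTorsion W p)
        (twistResEquiv W W₂ hd hV hθ κ (W₂.resOfLe p (kerStab_le κ θ) η')) := by
  simp only [h1Equiv_apply, resSubgroupH1, twistResEquiv, coeffH1Equiv_eq_subgroupH1Congr, toSubgroupOfH1,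
    subgroupH1Congr_apply, WeierstrassCurve.resOfLe, Literature.NumberTheory.EllipticCurves.resOfLe,
    resH1Hom_resH1Hom]
  exact congrFun (congrArg DFunLike.coe (resH1Hom_congr (by ext; rfl) (by ext; rfl) _ _)) η'

include hd hV hcθ in
/-- **The `±`-decomposition data over `K_∞`** (`IndexTwoDecompositionData` of `H1CorestrictionIndexTwo`): `G = ker κ`,
`N = kerStab κ θ` (its copy in `G`), `c`, `M = E[p^∞]`, `M′ = E₂[p^∞]`, `ψ`, `S = Sel_{p^∞}(E/K_∞)`,
`S′ = Sel_{p^∞}(E₂/K_∞)`, `T = Sel_{p^∞}(E/K_∞(θ))` transported into `H¹` of the copy of `N`, `a = 1`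
(`[ker κ : kerStab] = 2`; §2). [cite: DokchitserDokchitserAnnals2010, Lemma 4.14 (proof)]
[cite: GreenbergLNM1716, §4 p. 107] -/
def quadraticLayerData :
    haveI := normal_kerStab κ hθ
    IndexTwoDecompositionData ((kerStab κ θ).subgroupOf κ.kerSubgroup) (⟨c, hcκ⟩ : κ.kerSubgroup)
      (geomPrimaryTorsion W p) (geomPrimaryTorsion W₂ p) := by
  haveI := normal_kerStab κ hθ
  haveI := finiteIndex_kerStab_subgroupOf κ hd hθ hcκ hcθ
  exact
  { isOpen := isOpen_kerStab_subgroupOf κ θ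
    xor := xor_kerStab κ hd hθ hcκ hcθ
    continuous_smul := continuous_smul_ker κ W
    continuous_smul' := continuous_smul_ker κ W₂
    ψ := twistPrimaryEquiv W W₂ hd hV hθ p
    hψ := twistPrimaryEquiv_smul_subgroupOf κ W W₂ hd hV hθ
    hψc := twistPrimaryEquiv_smul_neg κ W W₂ hd hV hθ hcκ hcθ
    S := W.selmerInfty κ
    S' := W₂.selmerInfty κ
    T := (W.selmerGroupOver p (kerStab κ θ)).map (toSubgroupOfH1 (kerStab κ θ) κ.kerSubgroup (geomPrimaryTorsion W p))
    res_mem := fun η hη ↦ by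
      refine ⟨W.resOfLe p (kerStab_le κ θ) η, W.resOfLe_mem_selmerGroupOver p (kerStab_le κ θ) hη, ?_⟩
      rw [resSubgroupH1_subgroupOf_eq _ (kerStab_le κ θ)]
    res_mem' := fun η' hη' ↦ by
      refine ⟨twistResEquiv W W₂ hd hV hθ κ (W₂.resOfLe p (kerStab_le κ θ) η'), ?_, ?_⟩
      · exact (mem_selmerGroupOver_iff_twistResEquiv_mem W W₂ hd hV hθ κ _).mp
          (W₂.resOfLe_mem_selmerGroupOver p (kerStab_le κ θ) hη')
      · rw [h1Equiv_resSubgroupH1_eq]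
    conj_mem := by
      rintro _ ⟨y, hy, rfl⟩
      refine ⟨W.conjH1 p (kerStab κ θ) c y, W.map_conjH1_selmerGroupOver_le_holds p (kerStab κ θ) c ⟨y, hy, rfl⟩, ?_⟩
      rw [conjH1_toSubgroupOfH1]
    a := 1
    mem_of_res_mem := by
      rintro η ⟨y, hy, hyη⟩
      rw [resSubgroupH1_subgroupOf_eq _ (kerStab_le κ θ)] at hyη
      have hinj : y = W.resOfLe p (kerStab_le κ θ) η := by
        have h := congrArg (ofSubgroupOfH1 (geomPrimaryTorsion W p) (kerStab_le κ θ)) hyη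
        rwa [ofSubgroupOfH1_toSubgroupOfH1, ofSubgroupOfH1_toSubgroupOfH1] at h
      rw [hinj] at hy
      have h2 : (kerStab κ θ).relIndex κ.kerSubgroup • η ∈ W.selmerGroupOver p κ.kerSubgroup :=
        relIndex_nsmul_mem_selmerGroupOver_of_resOfLe_mem' W p (kerStab_le κ θ) (isOpen_kerStab_subgroupOf κ θ)
          (finiteIndex_kerStab_subgroupOf κ hd hθ hcκ hcθ) hy
      rw [relIndex_kerStab κ hd hθ hcκ hcθ] at h2
      show 2 ^ 1 • η ∈ W.selmerGroupOver p κ.kerSubgroup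
      rw [pow_one]
      exact h2
    mem_of_res_mem' := by
      rintro η' ⟨y, hy, hyη⟩
      rw [h1Equiv_resSubgroupH1_eq] at hyη
      have hinj : y = twistResEquiv W W₂ hd hV hθ κ (W₂.resOfLe p (kerStab_le κ θ) η') := by
        have h := congrArg (ofSubgroupOfH1 (geomPrimaryTorsion W p) (kerStab_le κ θ)) hyη
        rwa [ofSubgroupOfH1_toSubgroupOfH1, ofSubgroupOfH1_toSubgroupOfH1] at h
      rw [hinj] at hy
      have hres : W₂.resOfLe p (kerStab_le κ θ) η' ∈ W₂.selmerGroupOver p (kerStab κ θ) :=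
        (mem_selmerGroupOver_iff_twistResEquiv_mem W W₂ hd hV hθ κ _).mpr hy
      have h2 : (kerStab κ θ).relIndex κ.kerSubgroup • η' ∈ W₂.selmerGroupOver p κ.kerSubgroup :=
        relIndex_nsmul_mem_selmerGroupOver_of_resOfLe_mem' W₂ p (kerStab_le κ θ) (isOpen_kerStab_subgroupOf κ θ)
          (finiteIndex_kerStab_subgroupOf κ hd hθ hcκ hcθ) hres
      rw [relIndex_kerStab κ hd hθ hcκ hcθ] at h2
      show 2 ^ 1 • η' ∈ W₂.selmerGroupOver p κ.kerSubgroup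
      rw [pow_one]
      exact h2 }

end Data

/-! ## §5 Consequences for `Sel(E/K_∞) × Sel(E₂/K_∞) → Sel(E/K_∞(θ))`, `(η, η′) ↦ res η + Ψ(res η′)` -/

section Consequences

variable {K : Type u} [Field K] [NumberField K] {p : ℕ} [Fact p.Prime] (κ : ZpExtension K p)
  (W W₂ : WeierstrassCurve K) {d : K} (hd : d ≠ 0) {V : VariableChange K} (hV : V • W₂ = W.quadraticTwist d)
  {θ : AlgebraicClosure K} (hθ : θ ^ 2 = algebraMap K (AlgebraicClosure K) d)
  {c : Field.absoluteGaloisGroup K} (hcκ : c ∈ κ.kerSubgroup) (hcθ : c • θ = -θ)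

/-- **Restriction `Sel(E/K_∞) → Sel(E/K_∞(θ))`** as a homomorphism of the Selmer groups. [cite: GreenbergLNM1716, §4 p. 107] -/
def resSel [(kerStab κ θ).Normal] : W.selmerInfty κ →+ W.selmerGroupOver p (kerStab κ θ) :=
  ((W.resOfLe p (kerStab_le κ θ)).comp (W.selmerInfty κ).subtype).codRestrict _ fun η ↦
    W.resOfLe_mem_selmerGroupOver p (kerStab_le κ θ) η.2

/-- Values of `resSel`. [cite: GreenbergLNM1716, §4 p. 107] -/
@[simp]
theorem coe_resSel [(kerStab κ θ).Normal] (η : W.selmerInfty κ) :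
    ((resSel κ W (θ := θ) η : W.selmerGroupOver p (kerStab κ θ)) : W.subgroupH1 p (kerStab κ θ)) =
      W.resOfLe p (kerStab_le κ θ) η :=
  rfl

/-- **Twisted restriction `Sel(E₂/K_∞) → Sel(E/K_∞(θ))`, `η′ ↦ Ψ(res η′)`.** [cite: GreenbergLNM1716, §4 p. 107] -/
def twistResSel [(kerStab κ θ).Normal] : W₂.selmerInfty κ →+ W.selmerGroupOver p (kerStab κ θ) :=
  (((twistResEquiv W W₂ hd hV hθ κ : _ ≃+ _).toAddMonoidHom.comp
      ((W₂.resOfLe p (kerStab_le κ θ)).comp (W₂.selmerInfty κ).subtype)).codRestrict _) fun η' ↦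
    (mem_selmerGroupOver_iff_twistResEquiv_mem W W₂ hd hV hθ κ _).mp
      (W₂.resOfLe_mem_selmerGroupOver p (kerStab_le κ θ) η'.2)

/-- Values of `twistResSel`. [cite: GreenbergLNM1716, §4 p. 107] -/
@[simp]
theorem coe_twistResSel [(kerStab κ θ).Normal] (η' : W₂.selmerInfty κ) :
    ((twistResSel κ W W₂ hd hV hθ η' : W.selmerGroupOver p (kerStab κ θ)) : W.subgroupH1 p (kerStab κ θ)) =
      twistResEquiv W W₂ hd hV hθ κ (W₂.resOfLe p (kerStab_le κ θ) η') :=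
  rfl

/-- `resSel` commutes with `conj_σ` for every `σ ∈ Γ_K`. [cite: GreenbergLNM1716, §1 (p. 60)] -/
theorem coe_resSel_conj [(kerStab κ θ).Normal] (σ : Field.absoluteGaloisGroup K) (η : W.selmerInfty κ) :
    ((resSel κ W (θ := θ) (W.conjSelmerInfty κ σ η) : W.selmerGroupOver p (kerStab κ θ)) :
        W.subgroupH1 p (kerStab κ θ)) =
      W.conjH1 p (kerStab κ θ) σ (resSel κ W (θ := θ) η : W.selmerGroupOver p (kerStab κ θ)) := by
  rw [coe_resSel, coe_resSel, coe_conjSelmerInfty_apply]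
  exact congrArg (fun f ↦ f (η : W.subgroupH1 p κ.kerSubgroup))
    (resOfLe_comp_conjH1_holds (M := geomPrimaryTorsion W p) (kerStab_le κ θ) σ)

/-- `twistResSel` commutes with `conj_σ` for every `σ` FIXING `θ`. [cite: GreenbergLNM1716, §4 p. 107] -/
theorem coe_twistResSel_conj [(kerStab κ θ).Normal] {σ : Field.absoluteGaloisGroup K} (hσ : σ • θ = θ)
    (η' : W₂.selmerInfty κ) :
    ((twistResSel κ W W₂ hd hV hθ (W₂.conjSelmerInfty κ σ η') : W.selmerGroupOver p (kerStab κ θ)) :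
        W.subgroupH1 p (kerStab κ θ)) =
      W.conjH1 p (kerStab κ θ) σ (twistResSel κ W W₂ hd hV hθ η' : W.selmerGroupOver p (kerStab κ θ)) := by
  rw [coe_twistResSel, coe_twistResSel, coe_conjSelmerInfty_apply,
    ← twistResEquiv_conjH1_of_smul_eq W W₂ hd hV hθ κ hσ]
  congr 1
  exact congrArg (fun f ↦ f (η' : W₂.subgroupH1 p κ.kerSubgroup))
    (resOfLe_comp_conjH1_holds (M := geomPrimaryTorsion W₂ p) (kerStab_le κ θ) σ)

include hd hcκ hcθ in
/-- **The kernel of `(η, η′) ↦ res η + Ψ(res η′)` is killed by `4`.** [cite: DokchitserDokchitserAnnals2010, Lemma 4.14 (proof)] -/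
theorem four_nsmul_eq_zero_of_res_add_twistRes_eq_zero [(kerStab κ θ).Normal] (η : W.selmerInfty κ)
    (η' : W₂.selmerInfty κ)
    (h0 : (resSel κ W (θ := θ) η : W.selmerGroupOver p (kerStab κ θ)) + twistResSel κ W W₂ hd hV hθ η' = 0) :
    4 • η = 0 ∧ 4 • η' = 0 := by
  have h1 : Literature.NumberTheory.EllipticCurves.resOfLe (geomPrimaryTorsion W p) (kerStab_le κ θ)
        (η : W.subgroupH1 p κ.kerSubgroup) +
      twistResEquiv W W₂ hd hV hθ κ (W₂.resOfLe p (kerStab_le κ θ) η') = 0 := by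
    have h := congrArg (fun z : W.selmerGroupOver p (kerStab κ θ) ↦ (z : W.subgroupH1 p (kerStab κ θ))) h0
    simpa only [AddSubgroup.coe_add, coe_resSel, coe_twistResSel, ZeroMemClass.coe_zero] using h
  have hD : (quadraticLayerData κ W W₂ hd hV hθ hcκ hcθ).decompMap
      (⟨(η : W.subgroupH1 p κ.kerSubgroup), η.2⟩, ⟨(η' : W₂.subgroupH1 p κ.kerSubgroup), η'.2⟩) = 0 := by
    apply Subtype.ext
    rw [IndexTwoDecompositionData.coe_decompMap_apply, ZeroMemClass.coe_zero]
    change resSubgroupH1 _ _ (η : W.subgroupH1 p κ.kerSubgroup) +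
      h1Equiv (twistPrimaryEquiv W W₂ hd hV hθ p) (twistPrimaryEquiv_smul_subgroupOf κ W W₂ hd hV hθ)
        (resSubgroupH1 _ _ (η' : W₂.subgroupH1 p κ.kerSubgroup)) = 0
    rw [resSubgroupH1_subgroupOf_eq _ (kerStab_le κ θ), h1Equiv_resSubgroupH1_eq, ← map_add, h1, map_zero]
  have h4 := (quadraticLayerData κ W W₂ hd hV hθ hcκ hcθ).nsmul_eq_zero_of_decompMap_eq_zero _ hD
  simp only [Prod.smul_mk, Prod.mk_eq_zero] at h4
  obtain ⟨h4a, h4b⟩ := h4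
  exact ⟨Subtype.ext (congrArg Subtype.val h4a), Subtype.ext (congrArg Subtype.val h4b)⟩

include hd hcκ hcθ in
/-- **`4 · Sel(E/K_∞(θ))` lies in the image of `(η, η′) ↦ res η + Ψ(res η′)`.**
[cite: DokchitserDokchitserAnnals2010, Lemma 4.14 (proof)] -/
theorem exists_res_add_twistRes_eq_four_nsmul [(kerStab κ θ).Normal] (ζ : W.selmerGroupOver p (kerStab κ θ)) :
    ∃ (η : W.selmerInfty κ) (η' : W₂.selmerInfty κ),
      (resSel κ W (θ := θ) η : W.selmerGroupOver p (kerStab κ θ)) + twistResSel κ W W₂ hd hV hθ η' = 4 • ζ := by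
  have hζ : toSubgroupOfH1 (kerStab κ θ) κ.kerSubgroup (geomPrimaryTorsion W p) ζ ∈
      (quadraticLayerData κ W W₂ hd hV hθ hcκ hcθ).T := ⟨ζ, ζ.2, rfl⟩
  obtain ⟨⟨⟨η, hη⟩, ⟨η', hη'⟩⟩, hx⟩ :=
    (quadraticLayerData κ W W₂ hd hV hθ hcκ hcθ).pow_nsmul_mem_range_decompMap ⟨_, hζ⟩
  refine ⟨⟨η, hη⟩, ⟨η', hη'⟩, Subtype.ext ?_⟩
  have h := congrArg Subtype.val hx
  rw [IndexTwoDecompositionData.coe_decompMap_apply] at h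
  change resSubgroupH1 _ _ η +
      h1Equiv (twistPrimaryEquiv W W₂ hd hV hθ p) (twistPrimaryEquiv_smul_subgroupOf κ W W₂ hd hV hθ)
        (resSubgroupH1 _ _ η') =
    2 ^ (1 + 1) • toSubgroupOfH1 (kerStab κ θ) κ.kerSubgroup (geomPrimaryTorsion W p)
      (ζ : W.subgroupH1 p (kerStab κ θ)) at h
  rw [resSubgroupH1_subgroupOf_eq _ (kerStab_le κ θ), h1Equiv_resSubgroupH1_eq, ← map_add, ← map_nsmul] at h
  have h' := congrArg (ofSubgroupOfH1 (geomPrimaryTorsion W p) (kerStab_le κ θ)) h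
  rw [ofSubgroupOfH1_toSubgroupOfH1, ofSubgroupOfH1_toSubgroupOfH1] at h'
  rw [AddSubgroup.coe_add, coe_resSel, coe_twistResSel, AddSubmonoidClass.coe_nsmul,
    show (4 : ℕ) = 2 ^ (1 + 1) by norm_num]
  exact h'

end Consequences

end QuadraticLayer

end Literature.NumberTheory.EllipticCurves

end
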